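import Summits.BirchSwinnertonDyer.BirchSwinnertonDyer.Theorems.ErratumRoadFiveEulerHalfGenusLabelsLevel
import HarnessLib

/-!
# ErratumRoadFive ∕ EulerHalf ∕ genus line — (b2b-L♭) `GenusLabelsSupplyOdd[At]` FROM THE PRINTED FACTS on EVERY served frame,
# with NO `d_K (mod 8)` datum (helper, `--supports 23444`; part 2 of 2 — part 1 `…GenusLabelsLevel` proves the labels off `2N_W`)

Cell bsd-stepL, prover seat `bsd-stepL-imc-p1` g42 (idle hand on the genus line's open asks (R1)/(R2) of line owner bsd-idea-9 g26,
STATUS 2026-08-29T15:04:48Z; both were in-place mutations of landed definitions — `FrameProfile.d8`, the guard of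
`GenusLabelsSupply` — and are refused by the gate as `theorems.append-only`).  Sequel of `…GenusLabels` (p726922),
`…GenusLabelsSupply` (p727943) and Defs III″ (`…GenusClassDefs` §§5–6, p728234).

WHAT.
* `genusLabelsAt_of_facts_level` — p726922's `genusLabelsAt_of_facts` with a GENERAL level guard `N'`, `N_W ∣ N'`: the labels
  `ShimuraWalk.LabelsAt W N' K ι P Y ε` ((B4)/(B5) at the square-free levels prime to `N'` with inert prime factors) and the `±`
  identification, with `h2` asked only off `N'`.  Proof VERBATIM loc. cit. (one line changed: `ℓ ∤ N_W` is read off `ℓ ∤ N'`).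
* `genusLabelsAt_of_facts_odd` — the case `N' = 2N_W`: NO `h2` (an inert prime off `2N_W` is odd), i.e. the labels at the ODD
  admissible levels on EVERY presentation, `2` inert in `K` or not.
* `genusLabelsSupplyOddAt_of_presentation` ∕ `genusLabelsSupplyOddAt_of_printedFacts` ∕ **`genusLabelsSupplyOdd_of_printedFacts`** —
  p727943's two bridges re-run on `_odd`: the consumer-shaped supply `GenusLine.GenusLabelsSupplyOddAt W A p q K S` on every genus
  setting, and the line's Defs III″ input `GenusLine.GenusLabelsSupplyOdd` (∀ frames with the served `FrameProfile`), from the three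
  printed facts ALONE — no `d_K % 8` hypothesis, no `FrameProfile.d8`.  Why this suffices for the class-data child (b2b-κ): its levels
  are square-free products of Zhang Kolyvagin primes, odd for `p ≠ 3` (`GenusLine.ne_two_of_isKolyvaginPrime`,
  `GenusLine.not_dvd_two_mul_of_isKolyvaginPrime`, Defs III″ §5), hence inside the `2N_W` guard.

HONEST FRAMING: conditional on the three named printed facts (G1) `phi_heegnerPointOfConductor_mem_range_map_ringClassField_birch`,
(B5) `Nekovar2007.cmPoint_frobeniusCongruence`, (B3) `GrossLMS1991.prop53_conj_pinned_birch` (hypotheses, as in p726922/p727943);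
no crux and no stub is closed; `EulerHalfPOnlyMultPotMultTwinAtFive` is not proved; BSD is proved for no curve.
[cite: GrossLMS1991, §3 Prop. 3.7, §5 Prop. 5.3] [cite: Nekovar2007, Prop. 4.9] [cite: Darmon2004, Thm. 3.6] [cite: Cox2013, §5.B Prop. 5.16]
presearch: in-tree only (p726922, p727943, p728234); no new literature.
-/

noncomputable section

open scoped Classical ComplexConjugate

set_option linter.dupNamespace false
set_option autoImplicit false

namespace Summit.BirchSwinnertonDyer.BirchSwinnertonDyer.Theorems.GenusLine

open WeierstrassCurve NumberField Field IsDedekindDomain Literature.NumberTheory.EllipticCurves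
  Literature.NumberTheory.EllipticCurves.ModularForms
  Summit.BirchSwinnertonDyer.Rank1Residual.X11b
  Summit.BirchSwinnertonDyer.BirchSwinnertonDyer.Theorems.GenusKolyvagin

variable {K : Type} [Field K] [NumberField K]

/-! ## §3 The consumer-shaped supply `GenusLabelsSupplyOdd[At]` from the printed facts — no `d_K (mod 8)` datum -/

/-- **(b2b-L♭) PER PRESENTATION** — p727943's `genusLabelsSupplyAt_of_presentation` re-run on `genusLabelsAt_of_facts_odd`: the
hypothesis `d_K % 8 ≠ 5` is GONE; the labels are `LabelsAt W (2 * N_W) …`. [cite: GrossLMS1991, §3 Prop. 3.7, §5 Prop. 5.3]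
[cite: Nekovar2007, Prop. 4.9] [cite: Darmon2004, Thm. 3.6] -/
theorem genusLabelsSupplyOddAt_of_presentation
    (hG1 : ∀ (N : ℕ) [NeZero N] (W : WeierstrassCurve ℚ) (K : Type) [Field K] [NumberField K],
      phi_heegnerPointOfConductor_mem_range_map_ringClassField_birch N W K)
    (hNek : Nekovar2007.cmPoint_frobeniusCongruence)
    (hP53 : ∀ (N : ℕ) [NeZero N] (W : WeierstrassCurve ℚ) (K : Type) [Field K] [NumberField K],
      GrossLMS1991.prop53_conj_pinned_birch N W K)
    (W : WeierstrassCurve ℚ) [W.IsElliptic] [W.IsGloballyMinimal]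
    (hK : IsImaginaryQuadratic K) (ιc : K →+* ℂ)
    (E' : WeierstrassCurve ℚ) [E'.IsElliptic] [E'.IsGloballyMinimal] [NeZero (E'.conductorNorm ℤ)]
    (D C₂ : VariableChange ℚ) [(D • E').IsCharNeTwoNF] {d₁ d₂ : ℤ}
    (hd₁ : (d₁ % 4 = 1 ∧ Squarefree d₁ ∧ d₁ ≠ 1) ∨
      (4 ∣ d₁ ∧ (d₁ / 4 % 4 = 2 ∨ d₁ / 4 % 4 = 3) ∧ Squarefree (d₁ / 4)))
    (hd₂ : (d₂ % 4 = 1 ∧ Squarefree d₂ ∧ d₂ ≠ 1) ∨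
      (4 ∣ d₂ ∧ (d₂ / 4 % 4 = 2 ∨ d₂ / 4 % 4 = 3) ∧ Squarefree (d₂ / 4)))
    (hd : d₁ * d₂ = NumberField.discr K)
    (hE' : ∃ C : VariableChange ℚ, C • W.quadraticTwist (d₁ : ℚ) = E')
    (hWd : C₂ • (D • E').quadraticTwist (d₁ : ℚ) = W)
    (Dt : ModularParametrizationData E' (E'.conductorNorm ℤ)) {β : ℤ}
    (hβ : (4 * (E'.conductorNorm ℤ : ℤ)) ∣ β ^ 2 - NumberField.discr K)
    {θ : ringClassField K ιc 1} (hθ2 : θ ^ 2 = algebraMap ℚ (ringClassField K ιc 1) (d₁ : ℚ)) (hθ0 : θ ≠ 0)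
    (s : ringClassGal ιc 1 → ℤˣ)
    (hθσ : ∀ σ : ringClassGal ιc 1, σ.1 θ = ((s σ : ℤ) : ringClassField K ιc 1) * θ)
    {y : (E'.baseChange (ringClassField K ιc 1)).toAffine.Point}
    (hy : Affine.Point.map (ringClassField K ιc 1).subtype.toRatAlgHom y =
      heegnerPointComplexOfConductor Dt (NumberField.discr K) β 1)
    {instF : Fintype (ringClassGal ιc 1)}
    {P : (W.baseChange K).toAffine.Point}
    (hP : Affine.Point.map (algebraMap K (ringClassField K ιc 1)).toRatAlgHom P =
      Affine.Point.congrEquiv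
        (congrArg (fun X : WeierstrassCurve ℚ ↦ X.baseChange (ringClassField K ιc 1 : Type)) hWd)
        (VariableChange.pointEquivBaseChange ((D • E').quadraticTwist (d₁ : ℚ)) C₂ (ringClassField K ιc 1)
          ((VariableChange.pointEquiv (((D • E').quadraticTwist (d₁ : ℚ)).baseChange
              (ringClassField K ιc 1 : Type)) (untwistAt hθ0)).symm
            ((Affine.Point.congrEquiv (untwistAt_smul_eq (D • E') hθ2 hθ0)).symm
              (VariableChange.pointEquivBaseChange E' D (ringClassField K ιc 1)
                (∑ τ : ringClassGal ιc 1,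
                  (s τ : ℤ) • pointGalHom E' (ringClassField K ιc 1 : Type) τ.1 y)))))) :
    ∃ (yK : (W.baseChange K).toAffine.Point)
      (ys : (m : ℕ) → (W.baseChange (ringClassField K ιc m : Type)).toAffine.Point) (ε : ℤ),
      ShimuraWalk.LabelsAt W (2 * W.conductorNorm ℤ) K ιc yK ys ε ∧
      ∀ (c : ℕ), c ≠ 0 → c.Coprime (E'.conductorNorm ℤ) →
        ∀ (δ : GenusKolyvaginDatum E' K ιc Dt β d₁ c),
          genusTransport W E' D C₂ hWd K ιc δ = ys c ∨ genusTransport W E' D C₂ hWd K ιc δ = -ys c := by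
  subst hWd
  have hD4 : NumberField.discr K < -4 := GenusKolyvaginRC.discr_lt_neg_four_of_genus hK hd₁ hd₂ hd
  have hd₁K : d₁ ∣ NumberField.discr K := hd ▸ dvd_mul_right d₁ d₂
  obtain ⟨ys, ε, hL, hid⟩ :=
    genusLabelsAt_of_facts_odd hG1 hNek hP53 hK hD4 ιc E' D C₂ d₁ hE' hd₁K Dt hβ hθ2 hθ0 s hθσ hy hP
  exact ⟨P, ys, ε, hL, fun c hc hcN δ ↦ hid c hc hcN δ.hϑ2 δ.hϑ0 δ.hQ⟩

/-- **(b2b-L♭) ON EVERY GENUS SETTING** — `GenusLine.GenusLabelsSupplyOddAt W A p q K S` (Defs III″ §6) from the three printed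
facts, for `K` imaginary quadratic; NO `d_K % 8` hypothesis. [cite: GrossLMS1991, §3 Prop. 3.7, §5 Prop. 5.3]
[cite: Nekovar2007, Prop. 4.9] [cite: Darmon2004, Thm. 3.6] -/
theorem genusLabelsSupplyOddAt_of_printedFacts
    (hG1 : ∀ (N : ℕ) [NeZero N] (W : WeierstrassCurve ℚ) (K : Type) [Field K] [NumberField K],
      phi_heegnerPointOfConductor_mem_range_map_ringClassField_birch N W K)
    (hNek : Nekovar2007.cmPoint_frobeniusCongruence)
    (hP53 : ∀ (N : ℕ) [NeZero N] (W : WeierstrassCurve ℚ) (K : Type) [Field K] [NumberField K],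
      GrossLMS1991.prop53_conj_pinned_birch N W K)
    (W : WeierstrassCurve ℚ) [W.IsElliptic] [W.IsGloballyMinimal]
    (A : WeierstrassCurve ℚ) [A.IsElliptic] [A.IsGloballyMinimal] (p q : ℕ) [Fact p.Prime] [Fact q.Prime]
    (K : Type) [Field K] [NumberField K] (S : GenusHeegnerSettingRC W A p q K) (hK : IsImaginaryQuadratic K) :
    GenusLabelsSupplyOddAt W A p q K S := by
  haveI := S.ell; haveI := S.min; haveI := S.nz; haveI := S.nf
  exact genusLabelsSupplyOddAt_of_presentation hG1 hNek hP53 W hK S.ιc S.E' S.D S.C₂ S.hd₁ S.hd₂ S.hd S.hE'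
    S.hWd S.Dt S.hβ S.hθ2 S.hθ0 S.s S.hθσ S.hy S.hP

/-- **(b2b-L♭) THE LINE'S INPUT `GenusLabelsSupplyOdd` FROM THE PRINTED FACTS** (Defs III″ §6; ∀ genus settings with the served
`FrameProfile`, of which only `quad` is used) — the closer the line owner's memo §G.4 wanted for `GenusLabelsSupply`, in the
consumer-shaped currency and WITHOUT the `d8` datum. [cite: GrossLMS1991, §3 Prop. 3.7, §5 Prop. 5.3] [cite: Nekovar2007, Prop. 4.9]
[cite: Darmon2004, Thm. 3.6] -/
theorem genusLabelsSupplyOdd_of_printedFacts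
    (hG1 : ∀ (N : ℕ) [NeZero N] (W : WeierstrassCurve ℚ) (K : Type) [Field K] [NumberField K],
      phi_heegnerPointOfConductor_mem_range_map_ringClassField_birch N W K)
    (hNek : Nekovar2007.cmPoint_frobeniusCongruence)
    (hP53 : ∀ (N : ℕ) [NeZero N] (W : WeierstrassCurve ℚ) (K : Type) [Field K] [NumberField K],
      GrossLMS1991.prop53_conj_pinned_birch N W K) :
    GenusLabelsSupplyOdd := fun W _ _ A _ _ p q _ _ K _ _ S hprof ↦
  genusLabelsSupplyOddAt_of_printedFacts hG1 hNek hP53 W A p q K S hprof.quad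

end Summit.BirchSwinnertonDyer.BirchSwinnertonDyer.Theorems.GenusLine

end
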